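import Summits.QuantumFields.YangMills.Theorems.UnitScaleTiltProp7Chart47T3Defs
import Summits.QuantumFields.YangMills.Theorems.UnitScaleTiltProp7ChartSigmaT3
import HarnessLib

/-!
# `UnitScaleTiltProp7Chart5T3OfEq137cov` — (CH5-disp): ★w1-19200's displayed Prop.-5 row `Prop7ChartT3.Chart5T3` FROM ONE DISPLAYED HYPOTHESIS WHOSE
# FIBRE CLAUSE IS THE u-FREE EQUATION (1.37)^cov — the last conjunct of `Chart5T3` («EVERY (1.29)-restricted axial representative `(e^{iX}U₀)ᵘ` lies in the
# descent fibre of `V`») is, by ★w5-20520 g0's PROVED equivalence `Prop7ChartSigmaT3.gaugeAct_mem_fibre_iff_eq137cov_canonical` (p598418), implied by — and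
# under CHART-Σ equivalent to — the EQUATION `D_{n,K}(e^{iX}U₀)(c) = w(c₋)·V(c)·w(c₊)⁻¹`, `w = \overline{R_{0,·}e^{iX}}^{(k)}` ([Balaban1985Averaging] (85), the
# comb letter `B7Eq99Concrete.wrec` on the based pullbacks): no gauge transformation is quantified in the displayed text any more
# (route `UnitScaleTilt`, crux K1 «MinimiserStabilityRegPr» stmt-QuantumFields-19200, skeleton v10 stub `stub_existenceMinimalOrbit` (EX), route (α), cut (S3)(i);
# OWNER ym3-torus-plan g25 W-SEAT MAP pass #3 row M15 «`chart5T3_of_h137cov`»; def-free, count-neutral)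

Cell `ym3-torus` (HUMAN RULING D-0037, YM ladder rung R3 — YM₃ on T³ is a rung, not d = 4, not a mass gap, not Clay), width seat `ym-ust-20520-w5` (gen 3).

THE PRINT.  [Balaban1985RegularSpaces] p. 81–83: «The configurations U′ satisfy the equations Ũ′ʲ = V(Ū₀ʲ)⁻¹ on Λ_j, hence U₁ satisfies (Ũ₁^{u j})_b = … =
V_b(Ū₀ʲ)_b⁻¹ (1.30) … (1.31) … the condition (1.37) is basically of an algebraic character and it follows from the construction»; [Balaban1985Variational]
p. 299: «we apply to it a gauge transformation u satisfying the conditions R̄₀u = 1 on Λ_j and such that the gauge transformed configuration (U₁U₀)ᵘ satisfies the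
axial gauge conditions Ax_k(𝔅_k, U₀)».  ★w5 g0 LOCATED (RULING g25-№3) that for the route's SYMMETRIC (0.4) averaging the u-free form of «(U₁U₀)ᵘ ∈ 𝔅_k(𝔅_k, V)» is
(1.37)^cov (covariance [B7] (11) of the descent + [B7] (87) `u↓ = wrec⁻¹` on the comparison lattice), and proved the equivalence for EVERY restricted axial `u`.

WHAT IS PROVED (sorry-free, no definition; `k := K − n`, `x₀ := Prop7SPrint.basePt F n K`, canonical ℤ³ coordinates `z y := (siteShift y)·val` of the comparison
sites; the letters `𝒢, W, H₁, B, H, a, ε, ε₄, M` are the abstract ones of `Chart112T3` ∕ `Chart47T3` ∕ `Chart5T3`):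
* §1 CORE, one exponent `X`: **`fibreClause_of_eq137cov`** — (1.37)^cov for `e^{iX}U₀` ⟹ «every (1.29)-restricted axial representative `(e^{iX}U₀)ᵘ` lies in `fibre V`»
  (★w5 g0's iff, ⟸, u by u); **`eq137cov_of_fibreClause`** — the converse given ONE restricted axial `u` (CHART-Σ supplies it).
* §2 ★**`chart5T3_of_h137cov`** — `Prop7ChartT3.Chart5T3 F n K h ε₄ M V U₀ 𝒢 W H₁ B a ε H` from the displayed hypothesis `h137cov` := «`Chart47T3 … a ε U₀ H` → for every
  solution `A₁` of (111)[𝒢, W, H₁B] in the (115)-ball `ε₄`: ∃ `X` bondwise Hermitian traceless, `nMax19 X ≤ M(‖A₁‖ + ‖H₁B‖)`, (21) `IsLandauPrint`, and (1.37)^cov for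
  `D_{n,K}(e^{iX}U₀)`» (= `Chart5T3`'s text with its «∀ u …» fibre clause REPLACED by the u-free equation); `chart5T3_of_h137cov_exp` — the same with (1.37)^cov
  quantified over «every `U₁` with `U₁ = e^{iX}` bondwise» (the `h137` shape of `Prop7ChartSigmaT3.avgCondPrint_of_restrictedAxial_of_eq137cov` ∕
  `Prop7ChartSigmaT3GlevSU.avgCondPrint_of_windows_of_eq137cov`), via `eq_expHermField_of_exp`.
* §3 ★**`h5EL_of_h137covEL`** — the EL-threaded twin, ANTECEDENT-GENERIC (`P47 : Prop`): ★w2-19200 g2's knit binder `h5EL` of `Prop7StubEXOfChartPieces.hChart_of_pieces` ∕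
  `stubEX_of_chartPieces` (p601708; `Chart5T3`'s conclusion + the E–L conjunct, VERBATIM; v1 `P47 := Chart47T3 …`, v2-SYM `P47 := Chart47T3sym …` per RULING EX-KNIT №1 (R2))
  from `h137covEL` := `h137cov`'s conclusion with the same E–L conjunct appended.
* §4 **honest converse** `h137cov_of_chart5T3` — under CHART-Σ (`ChartSigmaT3 F n K e U₀`, PROVED from `RegPr` + windows by ★w5 g0's `chartSigmaT3_of_regPr`) and the knit's
  size window `0 ≤ M`, `M(ε₄ + ‖H₁B‖) < e`, `Chart5T3` gives `h137cov` back: the two displays carry THE SAME XL content ((112) ∘ Prop. 5 ∘ (123)–(140) ∘ PIN-B); M15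
  re-letters it u-free, it does not shrink it.
HONEST FRAMING.  Bookkeeping by name over landed letters; no estimate; nothing of [Balaban1985Variational]∕[Balaban1985RegularSpaces]∕[Balaban1985Averaging] is asserted;
`h137cov(EL)` stays DISPLAYED (its content is the EX node (CH5EL)); `--supports stmt-QuantumFields-19200 --as helper`.

References: T. Bałaban, CMP 99 (1985) 75–102 [Balaban1985RegularSpaces] ((1.19) p.79, (1.28)–(1.31) pp.81–82, (1.37) p.82, p.83); CMP 102 (1985) 277–309
[Balaban1985Variational] ((19)–(21) p.281, Prop. 5 p.294, (112) p.294, (123)–(140) pp.296–299, p.299); CMP 98 (1985) 17–51 [Balaban1985Averaging] ((11) p.19, (85)–(88) p.31).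
-/

set_option autoImplicit false

noncomputable section

namespace Summit.QuantumFields.YangMills.Theorems.Prop7Chart5T3OfEq137cov

open scoped Matrix.Norms.L2Operator
open NormedSpace
open Literature.MathematicalPhysics.QuantumFieldTheory.Balaban1983to89
open Literature.MathematicalPhysics.QuantumFieldTheory.Balaban1983to89.T3ContinuumYM3Torus
open Literature.MathematicalPhysics.QuantumFieldTheory.Balaban1983to89.T3LevelShift (siteShift)
open Literature.MathematicalPhysics.QuantumFieldTheory.Balaban1983to89.T3UnitLawDensityEML (ℰp)
open Literature.MathematicalPhysics.QuantumFieldTheory.Balaban1983to89.T3TiltDescent (descendTo)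
open Literature.MathematicalPhysics.QuantumFieldTheory.Balaban1983to89.T3ConstrainedMinimiser (fibre)
open Literature.MathematicalPhysics.QuantumFieldTheory.Balaban1983to89.T3PrintedRegularOrbits (sites_eq)
open B7Prop1Explicit renaming Site → LSite
open B7Eq99Concrete (wrec)
open B9SectCLatticeCarrier (Bond)
open B10Eq27TorusAxialLog (pull unitsField toUField)
open B11Eq115Space (NegSize Space115)
open B11Eq111FrakG (nabla115)
open B11Eq98CurrentSlot (Jcur)
open T3SectALandauChart (emb15)
open Summit.QuantumFields.YangMills.Theorems.Prop7SectET3Transport (periodsT3 bgOfCfg)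
open Summit.QuantumFields.YangMills.Theorems.Prop7SPrint (basePt IsAxialPrint RestrictedPrint IsLandauPrint)
open Summit.QuantumFields.YangMills.Theorems.Prop7TPrint (nMax19 expHermField expHermField_apply coe_expHerm)
open Summit.QuantumFields.YangMills.Theorems.Prop7ChartT3 (coarseBox Chart47T3 ChartSigmaT3 Chart5T3)
open Summit.QuantumFields.YangMills.Theorems.Prop7ChartSigmaT3 (gaugeAct_mem_fibre_iff_eq137cov_canonical eq137cov_of_avgCond_witness)

variable (F : T3Family) {n K : ℕ} (h : n ≤ K)

/-! ## §0 `expHermField X` is THE configuration with `U₁ = e^{iX}` bondwise -/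

/-- For bondwise Hermitian traceless `X`, `expHermField X` has the bond values `e^{iX_b}` (the exponential relation (19)∕(112)).
[cite: Balaban1985Variational, (19) p.281, (112) p.294] -/
theorem coe_expHermField_eq_exp (X : PBond (F.P K) 0 → Matrix (Fin 2) (Fin 2) ℂ)
    (hX : ∀ b : PBond (F.P K) 0, (X b).IsHermitian ∧ Matrix.trace (X b) = 0) (b : PBond (F.P K) 0) :
    ((expHermField (F := F) X b : Matrix.specialUnitaryGroup (Fin 2) ℂ) : Matrix (Fin 2) (Fin 2) ℂ) = exp (Complex.I • X b) := by
  rw [expHermField_apply, coe_expHerm (hX b)]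

/-- For bondwise Hermitian traceless `X`, a configuration with `U₁ = e^{iX}` bondwise IS `expHermField X` (the relation (19) determines `U₁`).
[cite: Balaban1985Variational, (19) p.281, (112) p.294] -/
theorem eq_expHermField_of_exp (X : PBond (F.P K) 0 → Matrix (Fin 2) (Fin 2) ℂ)
    (hX : ∀ b : PBond (F.P K) 0, (X b).IsHermitian ∧ Matrix.trace (X b) = 0)
    (U₁ : GaugeField (F.P K) 0 (Matrix.specialUnitaryGroup (Fin 2) ℂ))
    (hU₁ : ∀ b : PBond (F.P K) 0, ((U₁ b : Matrix.specialUnitaryGroup (Fin 2) ℂ) : Matrix (Fin 2) (Fin 2) ℂ) = exp (Complex.I • X b)) :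
    U₁ = expHermField X := by
  funext b
  apply Subtype.ext
  rw [hU₁ b, coe_expHermField_eq_exp F X hX b]

/-! ## §1 The core, one exponent `X`: (1.37)^cov ⟹ the fibre clause for EVERY restricted axial representative (and back, given one) -/

/-- **CORE (one exponent `X`)**: if `e^{iX}U₀` solves (1.37)^cov for `V` (canonical coordinates), then EVERY (1.29)-restricted `u` with `(e^{iX}U₀)ᵘ` axial puts `(e^{iX}U₀)ᵘ` in
the descent fibre of `V` — the ⟸ direction of ★w5 g0's `Prop7ChartSigmaT3.gaugeAct_mem_fibre_iff_eq137cov_canonical`, u by u (= `Chart5T3`'s last conjunct for this `X`).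
[cite: Balaban1985RegularSpaces, (1.28)–(1.31) pp.81–82, (1.37) p.82; Balaban1985Averaging, (11) p.19, (85)–(88) p.31] -/
theorem fibreClause_of_eq137cov (U₀ : GaugeField (F.P K) 0 (Matrix.specialUnitaryGroup (Fin 2) ℂ))
    (V : GaugeField (F.P n) 0 (Matrix.specialUnitaryGroup (Fin 2) ℂ)) (X : PBond (F.P K) 0 → Matrix (Fin 2) (Fin 2) ℂ)
    (h137 : ∀ c : PBond (F.P n) 0,
      unitsField (toUField (descendTo F ℰp n K h (emb15 U₀ (expHermField X)))) c
        = wrec (F.P K).L (pull (unitsField (toUField U₀)) (basePt F n K)) (pull (unitsField (toUField (expHermField (F := F) X))) (basePt F n K)) (K - n)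
            (fun μ => (((siteShift (sites_eq F n K h) c.src) μ).val : ℤ))
          * unitsField (toUField V) c
          * (wrec (F.P K).L (pull (unitsField (toUField U₀)) (basePt F n K)) (pull (unitsField (toUField (expHermField (F := F) X))) (basePt F n K)) (K - n)
            (fun μ => (((siteShift (sites_eq F n K h) c.tgt) μ).val : ℤ)))⁻¹) :
    ∀ u : GaugeTransf (F.P K) 0 (Matrix.specialUnitaryGroup (Fin 2) ℂ), RestrictedPrint F n K U₀ u →
      IsAxialPrint F n K U₀ (GaugeField.gaugeAct u (emb15 U₀ (expHermField X))) →
        GaugeField.gaugeAct u (emb15 U₀ (expHermField X)) ∈ fibre F ℰp n K h V :=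
  fun u hR hA => (gaugeAct_mem_fibre_iff_eq137cov_canonical F h u U₀ (expHermField X) hR hA V).2 h137

/-- **CORE, CONVERSELY**: given ONE (1.29)-restricted `u` with `(e^{iX}U₀)ᵘ` axial (CHART-Σ supplies it), the fibre clause for this `X` gives (1.37)^cov back
(`Prop7ChartSigmaT3.eq137cov_of_avgCond_witness`; print p. 83 «the condition (1.37) … follows from the construction»).
[cite: Balaban1985RegularSpaces, p.83, (1.29)–(1.31) pp.81–82, (1.37) p.82] -/
theorem eq137cov_of_fibreClause (U₀ : GaugeField (F.P K) 0 (Matrix.specialUnitaryGroup (Fin 2) ℂ))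
    (V : GaugeField (F.P n) 0 (Matrix.specialUnitaryGroup (Fin 2) ℂ)) (X : PBond (F.P K) 0 → Matrix (Fin 2) (Fin 2) ℂ)
    (u : GaugeTransf (F.P K) 0 (Matrix.specialUnitaryGroup (Fin 2) ℂ)) (hR : RestrictedPrint F n K U₀ u)
    (hA : IsAxialPrint F n K U₀ (GaugeField.gaugeAct u (emb15 U₀ (expHermField X))))
    (hfib : ∀ u : GaugeTransf (F.P K) 0 (Matrix.specialUnitaryGroup (Fin 2) ℂ), RestrictedPrint F n K U₀ u →
      IsAxialPrint F n K U₀ (GaugeField.gaugeAct u (emb15 U₀ (expHermField X))) →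
        GaugeField.gaugeAct u (emb15 U₀ (expHermField X)) ∈ fibre F ℰp n K h V) (c : PBond (F.P n) 0) :
    unitsField (toUField (descendTo F ℰp n K h (emb15 U₀ (expHermField X)))) c
      = wrec (F.P K).L (pull (unitsField (toUField U₀)) (basePt F n K)) (pull (unitsField (toUField (expHermField (F := F) X))) (basePt F n K)) (K - n)
          (fun μ => (((siteShift (sites_eq F n K h) c.src) μ).val : ℤ))
        * unitsField (toUField V) c
        * (wrec (F.P K).L (pull (unitsField (toUField U₀)) (basePt F n K)) (pull (unitsField (toUField (expHermField (F := F) X))) (basePt F n K)) (K - n)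
          (fun μ => (((siteShift (sites_eq F n K h) c.tgt) μ).val : ℤ)))⁻¹ :=
  eq137cov_of_avgCond_witness F h u U₀ (expHermField X) V hR hA (hfib u hR hA) c

/-! ## §2 `Chart5T3` from the u-free display `h137cov` -/

/-- ★ **(CH5-disp) `Chart5T3` FROM ONE DISPLAYED HYPOTHESIS WITH THE u-FREE FIBRE CLAUSE (1.37)^cov**: if, given Prop. 3's chart `Chart47T3 … a ε U₀ H`, every solution `A₁` of
(111)[𝒢, W, H₁B] in the (115)-ball `ε₄` yields an exponent `X` — bondwise Hermitian traceless, (19)-size `nMax19 X ≤ M(‖A₁‖ + ‖H₁B‖)`, (21) `IsLandauPrint` — whose configuration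
`e^{iX}U₀` solves the EQUATION (1.37)^cov `D_{n,K}(e^{iX}U₀)(c) = w(c₋)·V(c)·w(c₊)⁻¹` (`w = \overline{R_{0,·}e^{iX}}^{(k)}` = `wrec` on the based pullbacks, canonical coordinates),
then ★w1's displayed row `Chart5T3 F n K h ε₄ M V U₀ 𝒢 W H₁ B a ε H` holds: its fibre clause «every (1.29)-restricted axial representative `(e^{iX}U₀)ᵘ` lies in `fibre V`» is the
⟸ direction of `Prop7ChartSigmaT3.gaugeAct_mem_fibre_iff_eq137cov_canonical`, u by u.
[cite: Balaban1985RegularSpaces, (1.28)–(1.31) pp.81–82, (1.37) p.82, p.83; Balaban1985Variational, Prop. 5 p.294, (112) p.294, p.299; Balaban1985Averaging, (11) p.19, (85)–(88) p.31] -/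
theorem chart5T3_of_h137cov [Fact (0 < (F.L : ℝ))] [Fact (0 < ((F.L : ℝ)⁻¹) ^ (K - n))] {ε₄ M a ε : ℝ}
    {V : GaugeField (F.P n) 0 (Matrix.specialUnitaryGroup (Fin 2) ℂ)} {U₀ : GaugeField (F.P K) 0 (Matrix.specialUnitaryGroup (Fin 2) ℂ)}
    {𝒢 : NegSize (F.L : ℝ) (((F.L : ℝ)⁻¹) ^ (K - n)) (fun _ : Bond 3 (periodsT3 F K) => K - n) 3 (Matrix (Fin 2) (Fin 2) ℂ) →L[ℂ]
          Space115 (F.L : ℝ) (((F.L : ℝ)⁻¹) ^ (K - n)) (fun _ : Bond 3 (periodsT3 F K) => K - n) (fun _ : Bond 3 (periodsT3 F K) × Fin 3 => K - n)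
            (nabla115 (((F.L : ℝ)⁻¹) ^ (K - n)) (bgOfCfg F K U₀))}
    {W : Space115 (F.L : ℝ) (((F.L : ℝ)⁻¹) ^ (K - n)) (fun _ : Bond 3 (periodsT3 F K) => K - n) (fun _ : Bond 3 (periodsT3 F K) × Fin 3 => K - n)
            (nabla115 (((F.L : ℝ)⁻¹) ^ (K - n)) (bgOfCfg F K U₀)) →
          NegSize (F.L : ℝ) (((F.L : ℝ)⁻¹) ^ (K - n)) (fun _ : Bond 3 (periodsT3 F K) => K - n) 3 (Matrix (Fin 2) (Fin 2) ℂ)}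
    {β : Type} [Fintype β]
    {H₁ : (β → Matrix (Fin 2) (Fin 2) ℂ) →L[ℂ]
          Space115 (F.L : ℝ) (((F.L : ℝ)⁻¹) ^ (K - n)) (fun _ : Bond 3 (periodsT3 F K) => K - n) (fun _ : Bond 3 (periodsT3 F K) × Fin 3 => K - n)
            (nabla115 (((F.L : ℝ)⁻¹) ^ (K - n)) (bgOfCfg F K U₀))}
    {B : β → Matrix (Fin 2) (Fin 2) ℂ}
    {H : (↥(coarseBox F n K) → Matrix (Fin 2) (Fin 2) ℂ) →ₗ[ℂ] (PBond (F.P K) 0 → Matrix (Fin 2) (Fin 2) ℂ)}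
    (h137cov : Chart47T3 F n K a ε U₀ H →
      ∀ A₁ : Space115 (F.L : ℝ) (((F.L : ℝ)⁻¹) ^ (K - n)) (fun _ : Bond 3 (periodsT3 F K) => K - n) (fun _ : Bond 3 (periodsT3 F K) × Fin 3 => K - n)
            (nabla115 (((F.L : ℝ)⁻¹) ^ (K - n)) (bgOfCfg F K U₀)),
        ‖A₁‖ < ε₄ → A₁ + 𝒢 (Jcur (bgOfCfg F K U₀)) + 𝒢 (W (A₁ + H₁ B)) = 0 →
          ∃ X : PBond (F.P K) 0 → Matrix (Fin 2) (Fin 2) ℂ,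
            (∀ b : PBond (F.P K) 0, (X b).IsHermitian ∧ Matrix.trace (X b) = 0) ∧
            nMax19 F n K U₀ X ≤ M * (‖A₁‖ + ‖H₁ B‖) ∧ IsLandauPrint F n K U₀ X ∧
            ∀ c : PBond (F.P n) 0,
              unitsField (toUField (descendTo F ℰp n K h (emb15 U₀ (expHermField X)))) c
                = wrec (F.P K).L (pull (unitsField (toUField U₀)) (basePt F n K)) (pull (unitsField (toUField (expHermField (F := F) X))) (basePt F n K)) (K - n)
                    (fun μ => (((siteShift (sites_eq F n K h) c.src) μ).val : ℤ))
                  * unitsField (toUField V) c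
                  * (wrec (F.P K).L (pull (unitsField (toUField U₀)) (basePt F n K)) (pull (unitsField (toUField (expHermField (F := F) X))) (basePt F n K)) (K - n)
                    (fun μ => (((siteShift (sites_eq F n K h) c.tgt) μ).val : ℤ)))⁻¹) :
    Chart5T3 F n K h ε₄ M V U₀ 𝒢 W H₁ B a ε H := by
  intro h47 A₁ hA₁ h111
  obtain ⟨X, hX, hsize, h21, h137⟩ := h137cov h47 A₁ hA₁ h111
  exact ⟨X, hX, hsize, h21, fibreClause_of_eq137cov F h U₀ V X h137⟩

/-- **The same with (1.37)^cov QUANTIFIED OVER «every `U₁` with `U₁ = e^{iX}` bondwise»** — the `h137` shape of `Prop7ChartSigmaT3.avgCondPrint_of_restrictedAxial_of_eq137cov_canonical`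
∕ `Prop7ChartSigmaT3GlevSU.avgCondPrint_of_windows_of_eq137cov` (print's (19) «U₁ = exp iηA»); such `U₁` IS `expHermField X` (`eq_expHermField_of_exp`).
[cite: Balaban1985RegularSpaces, (1.28)–(1.31) pp.81–82, (1.37) p.82; Balaban1985Variational, (19)–(21) p.281, Prop. 5 p.294, (112) p.294, p.299] -/
theorem chart5T3_of_h137cov_exp [Fact (0 < (F.L : ℝ))] [Fact (0 < ((F.L : ℝ)⁻¹) ^ (K - n))] {ε₄ M a ε : ℝ}
    {V : GaugeField (F.P n) 0 (Matrix.specialUnitaryGroup (Fin 2) ℂ)} {U₀ : GaugeField (F.P K) 0 (Matrix.specialUnitaryGroup (Fin 2) ℂ)}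
    {𝒢 : NegSize (F.L : ℝ) (((F.L : ℝ)⁻¹) ^ (K - n)) (fun _ : Bond 3 (periodsT3 F K) => K - n) 3 (Matrix (Fin 2) (Fin 2) ℂ) →L[ℂ]
          Space115 (F.L : ℝ) (((F.L : ℝ)⁻¹) ^ (K - n)) (fun _ : Bond 3 (periodsT3 F K) => K - n) (fun _ : Bond 3 (periodsT3 F K) × Fin 3 => K - n)
            (nabla115 (((F.L : ℝ)⁻¹) ^ (K - n)) (bgOfCfg F K U₀))}
    {W : Space115 (F.L : ℝ) (((F.L : ℝ)⁻¹) ^ (K - n)) (fun _ : Bond 3 (periodsT3 F K) => K - n) (fun _ : Bond 3 (periodsT3 F K) × Fin 3 => K - n)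
            (nabla115 (((F.L : ℝ)⁻¹) ^ (K - n)) (bgOfCfg F K U₀)) →
          NegSize (F.L : ℝ) (((F.L : ℝ)⁻¹) ^ (K - n)) (fun _ : Bond 3 (periodsT3 F K) => K - n) 3 (Matrix (Fin 2) (Fin 2) ℂ)}
    {β : Type} [Fintype β]
    {H₁ : (β → Matrix (Fin 2) (Fin 2) ℂ) →L[ℂ]
          Space115 (F.L : ℝ) (((F.L : ℝ)⁻¹) ^ (K - n)) (fun _ : Bond 3 (periodsT3 F K) => K - n) (fun _ : Bond 3 (periodsT3 F K) × Fin 3 => K - n)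
            (nabla115 (((F.L : ℝ)⁻¹) ^ (K - n)) (bgOfCfg F K U₀))}
    {B : β → Matrix (Fin 2) (Fin 2) ℂ}
    {H : (↥(coarseBox F n K) → Matrix (Fin 2) (Fin 2) ℂ) →ₗ[ℂ] (PBond (F.P K) 0 → Matrix (Fin 2) (Fin 2) ℂ)}
    (h137exp : Chart47T3 F n K a ε U₀ H →
      ∀ A₁ : Space115 (F.L : ℝ) (((F.L : ℝ)⁻¹) ^ (K - n)) (fun _ : Bond 3 (periodsT3 F K) => K - n) (fun _ : Bond 3 (periodsT3 F K) × Fin 3 => K - n)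
            (nabla115 (((F.L : ℝ)⁻¹) ^ (K - n)) (bgOfCfg F K U₀)),
        ‖A₁‖ < ε₄ → A₁ + 𝒢 (Jcur (bgOfCfg F K U₀)) + 𝒢 (W (A₁ + H₁ B)) = 0 →
          ∃ X : PBond (F.P K) 0 → Matrix (Fin 2) (Fin 2) ℂ,
            (∀ b : PBond (F.P K) 0, (X b).IsHermitian ∧ Matrix.trace (X b) = 0) ∧
            nMax19 F n K U₀ X ≤ M * (‖A₁‖ + ‖H₁ B‖) ∧ IsLandauPrint F n K U₀ X ∧
            ∀ U₁ : GaugeField (F.P K) 0 (Matrix.specialUnitaryGroup (Fin 2) ℂ),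
              (∀ b : PBond (F.P K) 0, ((U₁ b : Matrix.specialUnitaryGroup (Fin 2) ℂ) : Matrix (Fin 2) (Fin 2) ℂ) = exp (Complex.I • X b)) →
                ∀ c : PBond (F.P n) 0,
                  unitsField (toUField (descendTo F ℰp n K h (emb15 U₀ U₁))) c
                    = wrec (F.P K).L (pull (unitsField (toUField U₀)) (basePt F n K)) (pull (unitsField (toUField U₁)) (basePt F n K)) (K - n)
                        (fun μ => (((siteShift (sites_eq F n K h) c.src) μ).val : ℤ))
                      * unitsField (toUField V) c
                      * (wrec (F.P K).L (pull (unitsField (toUField U₀)) (basePt F n K)) (pull (unitsField (toUField U₁)) (basePt F n K)) (K - n)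
                        (fun μ => (((siteShift (sites_eq F n K h) c.tgt) μ).val : ℤ)))⁻¹) :
    Chart5T3 F n K h ε₄ M V U₀ 𝒢 W H₁ B a ε H := by
  refine chart5T3_of_h137cov F h fun h47 A₁ hA₁ h111 => ?_
  obtain ⟨X, hX, hsize, h21, h137⟩ := h137exp h47 A₁ hA₁ h111
  exact ⟨X, hX, hsize, h21, h137 (expHermField X) (coe_expHermField_eq_exp F X hX)⟩

/-! ## §3 The EL-threaded twin, ANTECEDENT-GENERIC: ★w2-19200's knit binder `h5EL` (v1: `P47 := Chart47T3 …`; v2-SYM: `P47 := Chart47T3sym …`) from the u-free display -/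

/-- ★ **THE KNIT BINDER `h5EL` OF `Prop7StubEXOfChartPieces.hChart_of_pieces` ∕ `stubEX_of_chartPieces` (p601708) — `Chart5T3`'s conclusion PLUS the E–L conjunct, VERBATIM —
FROM THE u-FREE DISPLAY `h137covEL`** (`h137cov` with the same E–L conjunct appended), for an ARBITRARY antecedent `P47 : Prop`: `P47 := Chart47T3 F n K a ε U₀ H` is the v1 knit
(comb chart, ★w1's `Chart5T3` text), `P47 := Chart47T3sym F n K h C₂ ε U₀ H ∧ …` is the v2-SYM knit of RULING EX-KNIT №1 (R2) («CH5EL-sym, displayed INLINE binder premised on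
`Chart47T3sym … U₀ H`»); the fibre clause comes from (1.37)^cov by §1, the other four conjuncts pass through.  After this lemma the EX node (CH5EL) reads: (112) ∘ Prop. 5 ∘
(123)–(140) ∘ PIN-B delivering `X` with (19), (21), **(1.37)^cov**, and E–L — no gauge transformation quantified in its fibre clause.
[cite: Balaban1985Variational, Prop. 5 p.294, (112) p.294, (123)–(140) pp.296–299, p.299; Balaban1985RegularSpaces, (1.28)–(1.31) pp.81–82, (1.37) p.82] -/
theorem h5EL_of_h137covEL [Fact (0 < (F.L : ℝ))] [Fact (0 < ((F.L : ℝ)⁻¹) ^ (K - n))] {ε₄ M : ℝ} {P47 : Prop}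
    {V : GaugeField (F.P n) 0 (Matrix.specialUnitaryGroup (Fin 2) ℂ)} {U₀ : GaugeField (F.P K) 0 (Matrix.specialUnitaryGroup (Fin 2) ℂ)}
    {𝒢 : NegSize (F.L : ℝ) (((F.L : ℝ)⁻¹) ^ (K - n)) (fun _ : Bond 3 (periodsT3 F K) => K - n) 3 (Matrix (Fin 2) (Fin 2) ℂ) →L[ℂ]
          Space115 (F.L : ℝ) (((F.L : ℝ)⁻¹) ^ (K - n)) (fun _ : Bond 3 (periodsT3 F K) => K - n) (fun _ : Bond 3 (periodsT3 F K) × Fin 3 => K - n)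
            (nabla115 (((F.L : ℝ)⁻¹) ^ (K - n)) (bgOfCfg F K U₀))}
    {W : Space115 (F.L : ℝ) (((F.L : ℝ)⁻¹) ^ (K - n)) (fun _ : Bond 3 (periodsT3 F K) => K - n) (fun _ : Bond 3 (periodsT3 F K) × Fin 3 => K - n)
            (nabla115 (((F.L : ℝ)⁻¹) ^ (K - n)) (bgOfCfg F K U₀)) →
          NegSize (F.L : ℝ) (((F.L : ℝ)⁻¹) ^ (K - n)) (fun _ : Bond 3 (periodsT3 F K) => K - n) 3 (Matrix (Fin 2) (Fin 2) ℂ)}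
    {β : Type} [Fintype β]
    {H₁ : (β → Matrix (Fin 2) (Fin 2) ℂ) →L[ℂ]
          Space115 (F.L : ℝ) (((F.L : ℝ)⁻¹) ^ (K - n)) (fun _ : Bond 3 (periodsT3 F K) => K - n) (fun _ : Bond 3 (periodsT3 F K) × Fin 3 => K - n)
            (nabla115 (((F.L : ℝ)⁻¹) ^ (K - n)) (bgOfCfg F K U₀))}
    {B : β → Matrix (Fin 2) (Fin 2) ℂ}
    (h137covEL : P47 →
      ∀ A₁ : Space115 (F.L : ℝ) (((F.L : ℝ)⁻¹) ^ (K - n)) (fun _ : Bond 3 (periodsT3 F K) => K - n) (fun _ : Bond 3 (periodsT3 F K) × Fin 3 => K - n)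
            (nabla115 (((F.L : ℝ)⁻¹) ^ (K - n)) (bgOfCfg F K U₀)),
        ‖A₁‖ < ε₄ → A₁ + 𝒢 (Jcur (bgOfCfg F K U₀)) + 𝒢 (W (A₁ + H₁ B)) = 0 →
          ∃ X : PBond (F.P K) 0 → Matrix (Fin 2) (Fin 2) ℂ,
            (∀ b : PBond (F.P K) 0, (X b).IsHermitian ∧ Matrix.trace (X b) = 0) ∧
            nMax19 F n K U₀ X ≤ M * (‖A₁‖ + ‖H₁ B‖) ∧ IsLandauPrint F n K U₀ X ∧
            (∀ c : PBond (F.P n) 0,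
              unitsField (toUField (descendTo F ℰp n K h (emb15 U₀ (expHermField X)))) c
                = wrec (F.P K).L (pull (unitsField (toUField U₀)) (basePt F n K)) (pull (unitsField (toUField (expHermField (F := F) X))) (basePt F n K)) (K - n)
                    (fun μ => (((siteShift (sites_eq F n K h) c.src) μ).val : ℤ))
                  * unitsField (toUField V) c
                  * (wrec (F.P K).L (pull (unitsField (toUField U₀)) (basePt F n K)) (pull (unitsField (toUField (expHermField (F := F) X))) (basePt F n K)) (K - n)
                    (fun μ => (((siteShift (sites_eq F n K h) c.tgt) μ).val : ℤ)))⁻¹) ∧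
            (∀ u : GaugeTransf (F.P K) 0 (Matrix.specialUnitaryGroup (Fin 2) ℂ), RestrictedPrint F n K U₀ u →
              GaugeField.gaugeAct u (emb15 U₀ (expHermField X)) ∈ fibre F ℰp n K h V →
              ∀ γ : ℝ → GaugeField (F.P K) 0 (Matrix.specialUnitaryGroup (Fin 2) ℂ), γ 0 = GaugeField.gaugeAct u (emb15 U₀ (expHermField X)) →
                (∀ t, γ t ∈ fibre F ℰp n K h V) →
                (∀ b, DifferentiableAt ℝ (fun t => ((γ t b : Matrix.specialUnitaryGroup (Fin 2) ℂ) : Matrix (Fin 2) (Fin 2) ℂ)) 0) →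
                  deriv (fun t => wilsonAction4 (γ t)) 0 = 0)) :
    P47 →
      ∀ A₁ : Space115 (F.L : ℝ) (((F.L : ℝ)⁻¹) ^ (K - n)) (fun _ : Bond 3 (periodsT3 F K) => K - n) (fun _ : Bond 3 (periodsT3 F K) × Fin 3 => K - n)
            (nabla115 (((F.L : ℝ)⁻¹) ^ (K - n)) (bgOfCfg F K U₀)),
        ‖A₁‖ < ε₄ → A₁ + 𝒢 (Jcur (bgOfCfg F K U₀)) + 𝒢 (W (A₁ + H₁ B)) = 0 →
          ∃ X : PBond (F.P K) 0 → Matrix (Fin 2) (Fin 2) ℂ,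
            (∀ b : PBond (F.P K) 0, (X b).IsHermitian ∧ Matrix.trace (X b) = 0) ∧
            nMax19 F n K U₀ X ≤ M * (‖A₁‖ + ‖H₁ B‖) ∧ IsLandauPrint F n K U₀ X ∧
            (∀ u : GaugeTransf (F.P K) 0 (Matrix.specialUnitaryGroup (Fin 2) ℂ), RestrictedPrint F n K U₀ u →
              IsAxialPrint F n K U₀ (GaugeField.gaugeAct u (emb15 U₀ (expHermField X))) →
                GaugeField.gaugeAct u (emb15 U₀ (expHermField X)) ∈ fibre F ℰp n K h V) ∧
            (∀ u : GaugeTransf (F.P K) 0 (Matrix.specialUnitaryGroup (Fin 2) ℂ), RestrictedPrint F n K U₀ u →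
              GaugeField.gaugeAct u (emb15 U₀ (expHermField X)) ∈ fibre F ℰp n K h V →
              ∀ γ : ℝ → GaugeField (F.P K) 0 (Matrix.specialUnitaryGroup (Fin 2) ℂ), γ 0 = GaugeField.gaugeAct u (emb15 U₀ (expHermField X)) →
                (∀ t, γ t ∈ fibre F ℰp n K h V) →
                (∀ b, DifferentiableAt ℝ (fun t => ((γ t b : Matrix.specialUnitaryGroup (Fin 2) ℂ) : Matrix (Fin 2) (Fin 2) ℂ)) 0) →
                  deriv (fun t => wilsonAction4 (γ t)) 0 = 0) := by
  intro h47 A₁ hA₁ h111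
  obtain ⟨X, hX, hsize, h21, h137, hEL⟩ := h137covEL h47 A₁ hA₁ h111
  exact ⟨X, hX, hsize, h21, fibreClause_of_eq137cov F h U₀ V X h137, hEL⟩

/-! ## §4 Honest converse: under CHART-Σ and the size window the two displays are equivalent -/

/-- **`Chart5T3` GIVES `h137cov` BACK UNDER CHART-Σ** (`ChartSigmaT3 F n K e U₀`, PROVED from `RegPr` + windows by `Prop7ChartSigmaT3OfRegPr.chartSigmaT3_of_regPr`) and the knit's size
window `0 ≤ M`, `M(ε₄ + ‖H₁B‖) < e`: CHART-Σ supplies ONE restricted axial `u` at the exponent `X` (size `< e`), `Chart5T3` puts `(e^{iX}U₀)ᵘ` in `fibre V`, and every Σ_k witness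
satisfies (1.37)^cov (`Prop7ChartSigmaT3.eq137cov_of_avgCond_witness`; print p. 83 «the condition (1.37) … follows from the construction»).  So M15 re-letters the (CH5EL) display
u-free; the XL content ((112) ∘ Prop. 5 ∘ (123)–(140) ∘ PIN-B) is unchanged.
[cite: Balaban1985RegularSpaces, p.83, (1.29)–(1.31) pp.81–82, (1.37) p.82; Balaban1985Variational, Prop. 5 p.294, (112) p.294, p.299] -/
theorem h137cov_of_chart5T3 [Fact (0 < (F.L : ℝ))] [Fact (0 < ((F.L : ℝ)⁻¹) ^ (K - n))] {ε₄ M e a ε : ℝ}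
    {V : GaugeField (F.P n) 0 (Matrix.specialUnitaryGroup (Fin 2) ℂ)} {U₀ : GaugeField (F.P K) 0 (Matrix.specialUnitaryGroup (Fin 2) ℂ)}
    {𝒢 : NegSize (F.L : ℝ) (((F.L : ℝ)⁻¹) ^ (K - n)) (fun _ : Bond 3 (periodsT3 F K) => K - n) 3 (Matrix (Fin 2) (Fin 2) ℂ) →L[ℂ]
          Space115 (F.L : ℝ) (((F.L : ℝ)⁻¹) ^ (K - n)) (fun _ : Bond 3 (periodsT3 F K) => K - n) (fun _ : Bond 3 (periodsT3 F K) × Fin 3 => K - n)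
            (nabla115 (((F.L : ℝ)⁻¹) ^ (K - n)) (bgOfCfg F K U₀))}
    {W : Space115 (F.L : ℝ) (((F.L : ℝ)⁻¹) ^ (K - n)) (fun _ : Bond 3 (periodsT3 F K) => K - n) (fun _ : Bond 3 (periodsT3 F K) × Fin 3 => K - n)
            (nabla115 (((F.L : ℝ)⁻¹) ^ (K - n)) (bgOfCfg F K U₀)) →
          NegSize (F.L : ℝ) (((F.L : ℝ)⁻¹) ^ (K - n)) (fun _ : Bond 3 (periodsT3 F K) => K - n) 3 (Matrix (Fin 2) (Fin 2) ℂ)}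
    {β : Type} [Fintype β]
    {H₁ : (β → Matrix (Fin 2) (Fin 2) ℂ) →L[ℂ]
          Space115 (F.L : ℝ) (((F.L : ℝ)⁻¹) ^ (K - n)) (fun _ : Bond 3 (periodsT3 F K) => K - n) (fun _ : Bond 3 (periodsT3 F K) × Fin 3 => K - n)
            (nabla115 (((F.L : ℝ)⁻¹) ^ (K - n)) (bgOfCfg F K U₀))}
    {B : β → Matrix (Fin 2) (Fin 2) ℂ}
    {H : (↥(coarseBox F n K) → Matrix (Fin 2) (Fin 2) ℂ) →ₗ[ℂ] (PBond (F.P K) 0 → Matrix (Fin 2) (Fin 2) ℂ)}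
    (hSig : ChartSigmaT3 F n K e U₀) (hM : 0 ≤ M) (hMe : M * (ε₄ + ‖H₁ B‖) < e)
    (h5 : Chart5T3 F n K h ε₄ M V U₀ 𝒢 W H₁ B a ε H) :
    Chart47T3 F n K a ε U₀ H →
      ∀ A₁ : Space115 (F.L : ℝ) (((F.L : ℝ)⁻¹) ^ (K - n)) (fun _ : Bond 3 (periodsT3 F K) => K - n) (fun _ : Bond 3 (periodsT3 F K) × Fin 3 => K - n)
            (nabla115 (((F.L : ℝ)⁻¹) ^ (K - n)) (bgOfCfg F K U₀)),
        ‖A₁‖ < ε₄ → A₁ + 𝒢 (Jcur (bgOfCfg F K U₀)) + 𝒢 (W (A₁ + H₁ B)) = 0 →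
          ∃ X : PBond (F.P K) 0 → Matrix (Fin 2) (Fin 2) ℂ,
            (∀ b : PBond (F.P K) 0, (X b).IsHermitian ∧ Matrix.trace (X b) = 0) ∧
            nMax19 F n K U₀ X ≤ M * (‖A₁‖ + ‖H₁ B‖) ∧ IsLandauPrint F n K U₀ X ∧
            ∀ c : PBond (F.P n) 0,
              unitsField (toUField (descendTo F ℰp n K h (emb15 U₀ (expHermField X)))) c
                = wrec (F.P K).L (pull (unitsField (toUField U₀)) (basePt F n K)) (pull (unitsField (toUField (expHermField (F := F) X))) (basePt F n K)) (K - n)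
                    (fun μ => (((siteShift (sites_eq F n K h) c.src) μ).val : ℤ))
                  * unitsField (toUField V) c
                  * (wrec (F.P K).L (pull (unitsField (toUField U₀)) (basePt F n K)) (pull (unitsField (toUField (expHermField (F := F) X))) (basePt F n K)) (K - n)
                    (fun μ => (((siteShift (sites_eq F n K h) c.tgt) μ).val : ℤ)))⁻¹ := by
  intro h47 A₁ hA₁ h111
  obtain ⟨X, hX, hsize, h21, hfib⟩ := h5 h47 A₁ hA₁ h111
  refine ⟨X, hX, hsize, h21, ?_⟩
  -- CHART-Σ at the size of `X`: one restricted axial `u`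
  have hlt : nMax19 F n K U₀ X < e := by
    have h1 : M * (‖A₁‖ + ‖H₁ B‖) ≤ M * (ε₄ + ‖H₁ B‖) := mul_le_mul_of_nonneg_left (by linarith) hM
    exact lt_of_le_of_lt (hsize.trans h1) hMe
  obtain ⟨u, hR, hA⟩ := hSig X hX hlt
  exact eq137cov_of_fibreClause F h U₀ V X u hR hA hfib

end Summit.QuantumFields.YangMills.Theorems.Prop7Chart5T3OfEq137cov

end
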